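import Mathlib.ModelTheory.Algebra.Field.CharP
import Mathlib.ModelTheory.Satisfiability
import Mathlib.Algebra.CharP.Basic
import Literature.ModelTheory.PseudofiniteFields.FiniteFieldTheory

/-!
# Transfer from pseudo-finite fields of characteristic zero to finite fields of large characteristic

Z. Chatzidakis, L. van den Dries, A. Macintyre, *Definable sets over finite fields*, J. reine
angew. Math. **427** (1992) 107–135 (bib key ChatzidakisVanDenDriesMacintyre1992), p. 110 and
Prop. (2.7): a pseudo-finite field is an infinite model of `finiteFieldTheory`, the set of ring
sentences true in all finite fields, and a sentence true in all pseudo-finite fields is true in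
all sufficiently LARGE finite fields ("by pure logic" — compactness;
`FiniteField.eventually_realize_of_pseudoFinite` in `FiniteFieldTheory.lean`).

This file records the companion transfer along the CHARACTERISTIC:

* `FiniteField.eventually_realize_of_pseudoFinite_charZero`: **a ring sentence true in every
  pseudo-finite field of characteristic `0` is true in every finite field of sufficiently large
  characteristic** — if every field `K` of characteristic `0` with `K ⊨ finiteFieldTheory`
  satisfies `σ`, then there is `q₀` such that every finite field `F` with `char F ≥ q₀`
  satisfies `σ`.  (Fields of characteristic `0` are infinite, so these `K` are exactly the
  pseudo-finite fields of characteristic `0`; conversely the conclusion cannot be strengthened to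
  "`|F| ≥ q₀`", since `σ` may fail in pseudo-finite fields of positive characteristic, e.g.
  `σ = ¬ (2 = 0)`.)
* `FiniteField.eventually_realize_forall_of_pseudoFinite_charZero`,
  `FiniteField.eventually_realize_iff_of_pseudoFinite_charZero`: the same for a formula holding
  identically, resp. for an equivalence of two formulas, in finitely many free variables.

Proof: by the compactness theorem. If finite fields of unbounded characteristic falsified `σ`,
then every finite fragment of `finiteFieldTheory ∪ Theory.fieldOfChar 0 ∪ {¬σ}` — where Mathlib's
`Theory.fieldOfChar 0` is the field axioms together with `¬ (p = 0)` for all primes `p` — would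
hold in a finite field of characteristic exceeding the finitely many primes mentioned; so the
whole theory would have a model, i.e. (made into a field by Mathlib's `fieldOfModelField`) a
field of characteristic `0` satisfying `finiteFieldTheory` and falsifying `σ`.  This is the
standard argument behind every "for all finite fields of sufficiently large characteristic"
statement obtained from characteristic-`0` pseudo-finite fields (cf. [Ax1968], and
[FriedJarden2008, Ch. 20] for the ultraproduct formulation); no source states it in exactly this
form, so the declarations are tagged folklore with a pointer to CDM (2.7).

## References

* [ChatzidakisVanDenDriesMacintyre1992] Z. Chatzidakis, L. van den Dries, A. Macintyre, Definable
  sets over finite fields, J. reine angew. Math. 427 (1992) 107–135, p. 110 and Prop. (2.7).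
* [Ax1968] J. Ax, The elementary theory of finite fields, Ann. of Math. 88 (1968) 239–271.
* [FriedJarden2008] M. D. Fried, M. Jarden, Field Arithmetic, 3rd ed., Springer 2008, Ch. 20.
-/

namespace Literature.ModelTheory.PseudofiniteFields

open FirstOrder FirstOrder.Language FirstOrder.Ring FirstOrder.Field
open scoped FirstOrder

namespace FiniteField

/-- Mathlib's theory of fields of characteristic `0`, unfolded: the field axioms together with
the sentences `¬ (q = 0)`, `q` prime. [folklore] -/
theorem fieldOfChar_zero_eq :
    Theory.fieldOfChar 0 =
      FirstOrder.Language.Theory.field ∪ (fun q => ∼(eqZero q)) '' {q : ℕ | q.Prime} := by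
  rw [Theory.fieldOfChar, if_pos rfl]

/-- A finite field whose characteristic exceeds the prime `q` satisfies `¬ (q = 0)`.
[folklore] -/
theorem realize_not_eqZero_of_lt_ringChar (F : Type) [Field F] {q : ℕ} (hq : q.Prime)
    (hqF : q < ringChar F) : (letI := compatibleRingOfRing F; F ⊨ ∼(eqZero q)) := by
  letI := compatibleRingOfRing F
  rw [Sentence.Realize, Formula.realize_not, realize_eqZero]
  intro h0
  have hdvd : ringChar F ∣ q := (ringChar.spec F q).1 h0
  exact absurd hqF (not_lt.2 (Nat.le_of_dvd hq.pos hdvd))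

/-- **Transfer from pseudo-finite fields of characteristic zero to finite fields of large
characteristic (compactness).** If a sentence `σ` of the language of rings holds in every field
of characteristic `0` satisfying all sentences true in all finite fields (such a field is
infinite, i.e. it is a pseudo-finite field of characteristic `0`), then there is `q₀` such that
`σ` holds in every finite field of characteristic at least `q₀`.  Proof: otherwise finite fields
of unbounded characteristic falsify `σ`, so every finite part of
`finiteFieldTheory ∪ Theory.fieldOfChar 0 ∪ {¬σ}` has a finite field as a model (one whose
characteristic exceeds the primes `q` with `¬(q = 0)` in the finite part); by the compactness
theorem the whole theory has a model, which (made into a field by `fieldOfModelField`) is a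
characteristic-`0` field satisfying `finiteFieldTheory` and falsifying `σ`.
[folklore] (cf. [ChatzidakisVanDenDriesMacintyre1992, (2.7) "by pure logic" and p. 110]) -/
theorem eventually_realize_of_pseudoFinite_charZero (σ : Language.ring.Sentence)
    (h : ∀ (K : Type) [Field K] [CompatibleRing K] [CharZero K], K ⊨ finiteFieldTheory → K ⊨ σ) :
    ∃ q₀ : ℕ, ∀ (F : Type) [Field F] [Fintype F], q₀ ≤ ringChar F →
      (letI := compatibleRingOfRing F; F ⊨ σ) := by
  classical
  by_contra hcon
  push Not at hcon
  -- `hcon : ∀ q₀, ∃ F, finite field, q₀ ≤ ringChar F ∧ ¬ F ⊨ σ`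
  set T : Language.ring.Theory := finiteFieldTheory ∪ Theory.fieldOfChar 0 ∪ {σ.not} with hT
  -- every finite fragment of `T` has a finite field as a model
  have hfin : T.IsFinitelySatisfiable := by
    intro T0 hT0
    -- a bound for the primes occurring in the characteristic axioms of `T0`
    have hchar : ∀ τ : Language.ring.Sentence, ∃ n : ℕ,
        τ ∈ (fun q => ∼(eqZero q)) '' {q : ℕ | q.Prime} → n.Prime ∧ τ = ∼(eqZero n) := by
      intro τ
      by_cases hτ : τ ∈ (fun q => ∼(eqZero q)) '' {q : ℕ | q.Prime}
      · obtain ⟨q, hq, rfl⟩ := hτ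
        exact ⟨q, fun _ => ⟨hq, rfl⟩⟩
      · exact ⟨0, fun h => (hτ h).elim⟩
    choose nOf hnOf using hchar
    obtain ⟨F, _, _, hqF, hFσ⟩ := hcon (T0.sup nOf + 1)
    letI := compatibleRingOfRing F
    have hF : F ⊨ (T0 : Language.ring.Theory) := by
      refine ⟨fun τ hτ => ?_⟩
      have hτT := hT0 hτ
      simp only [hT, fieldOfChar_zero_eq, Set.mem_union, Set.mem_singleton_iff] at hτT
      rcases hτT with (hτ1 | hτ2 | hτ3) | hτ4
      · exact hτ1 F
      · exact Theory.realize_sentence_of_mem FirstOrder.Language.Theory.field hτ2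
      · obtain ⟨hprime, hτeq⟩ := hnOf τ hτ3
        rw [hτeq]
        refine realize_not_eqZero_of_lt_ringChar F hprime (lt_of_lt_of_le ?_ hqF)
        exact Nat.lt_succ_of_le (Finset.le_sup (f := nOf) (Finset.mem_coe.1 hτ))
      · subst hτ4
        exact (Sentence.realize_not (M := F)).2 hFσ
    exact Theory.Model.isSatisfiable F
  -- hence `T` has a model: a characteristic-`0` pseudo-finite field falsifying `σ`
  obtain ⟨M⟩ := Theory.isSatisfiable_iff_isFinitelySatisfiable.2 hfin
  have hMT : (M : Type) ⊨ T := M.is_model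
  have hM1 : (M : Type) ⊨ finiteFieldTheory :=
    hMT.mono (Set.subset_union_left.trans Set.subset_union_left)
  have hM2 : (M : Type) ⊨ Theory.fieldOfChar 0 :=
    hMT.mono (Set.subset_union_right.trans Set.subset_union_left)
  have hM3 : (M : Type) ⊨ σ.not :=
    hMT.realize_of_mem _ (Set.mem_union_right _ (Set.mem_singleton _))
  haveI : (M : Type) ⊨ FirstOrder.Language.Theory.field :=
    hM1.mono field_subset_finiteFieldTheory
  letI : Field M := fieldOfModelField M
  letI : CompatibleRing M := compatibleRingOfModelField M
  haveI : CharZero M := by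
    haveI : CharP (M : Type) 0 := @charP_of_model_fieldOfChar 0 M _ _ hM2
    exact CharP.charP_to_charZero M
  exact (Sentence.realize_not (M := M)).1 hM3 (h M hM1)

/-- **Transfer of equivalences along the characteristic.** If two ring formulas `φ(v)`, `ψ(v)`
in finitely many free variables are equivalent in every pseudo-finite field of characteristic
`0`, then they are equivalent in every finite field of sufficiently large characteristic.
[folklore] (cf. [ChatzidakisVanDenDriesMacintyre1992, (2.7)]) -/
theorem eventually_realize_iff_of_pseudoFinite_charZero {α : Type} [Finite α]
    (φ ψ : Language.ring.Formula α)
    (h : ∀ (K : Type) [Field K] [CompatibleRing K] [CharZero K], K ⊨ finiteFieldTheory →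
      ∀ v : α → K, φ.Realize v ↔ ψ.Realize v) :
    ∃ q₀ : ℕ, ∀ (F : Type) [Field F] [Fintype F], q₀ ≤ ringChar F →
      ∀ v : α → F, (letI := compatibleRingOfRing F; φ.Realize v ↔ ψ.Realize v) := by
  obtain ⟨q₀, hq₀⟩ := eventually_realize_of_pseudoFinite_charZero
    (((φ.iff ψ).relabel (Sum.inr : α → Empty ⊕ α)).iAlls α) fun K _ _ _ hK => by
      rw [realize_iAlls_relabel_inr_iff]
      intro v
      exact Formula.realize_iff.2 (h K hK v)
  refine ⟨q₀, fun F _ _ hF v => ?_⟩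
  letI := compatibleRingOfRing F
  have := (realize_iAlls_relabel_inr_iff (φ.iff ψ) F).1 (hq₀ F hF) v
  exact Formula.realize_iff.1 this

/-- **Transfer of a uniform property along the characteristic.** If a ring formula `φ(v)` in
finitely many free variables holds identically in every pseudo-finite field of characteristic
`0`, then it holds identically in every finite field of sufficiently large characteristic.
[folklore] (cf. [ChatzidakisVanDenDriesMacintyre1992, (2.7)]) -/
theorem eventually_realize_forall_of_pseudoFinite_charZero {α : Type} [Finite α]
    (φ : Language.ring.Formula α)
    (h : ∀ (K : Type) [Field K] [CompatibleRing K] [CharZero K], K ⊨ finiteFieldTheory →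
      ∀ v : α → K, φ.Realize v) :
    ∃ q₀ : ℕ, ∀ (F : Type) [Field F] [Fintype F], q₀ ≤ ringChar F →
      ∀ v : α → F, (letI := compatibleRingOfRing F; φ.Realize v) := by
  obtain ⟨q₀, hq₀⟩ := eventually_realize_of_pseudoFinite_charZero
    ((φ.relabel (Sum.inr : α → Empty ⊕ α)).iAlls α) fun K _ _ _ hK => by
      rw [realize_iAlls_relabel_inr_iff]
      exact h K hK
  refine ⟨q₀, fun F _ _ hF v => ?_⟩
  letI := compatibleRingOfRing F
  exact (realize_iAlls_relabel_inr_iff φ F).1 (hq₀ F hF) v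

end FiniteField

end Literature.ModelTheory.PseudofiniteFields
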